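import Mathlib
import Summits.Ventures.PercRepro2.SwOutAll
import Summits.Ventures.PercRepro2.SwOutArmFlip
import Summits.Ventures.PercRepro2.SwOutArms
import Summits.Ventures.PercRepro2.SwOutArmOrbit
import Summits.Ventures.PercRepro2.SwOutArmCube
import Summits.Ventures.PercRepro2.SwOutArmThm
import Summits.Ventures.PercRepro2.SwOutJunctionFine
import Summits.Ventures.PercRepro2.SwOutJunctionRegion
import Summits.Ventures.PercRepro2.SwOutJunction
import Summits.Ventures.PercRepro2.SwOutJunctionsSplit
import Summits.Ventures.PercRepro2.SwOutJunctionsFine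
import Summits.Ventures.PercRepro2.SwOutJunctionsRegion
import Summits.Ventures.PercRepro2.SwOutJunctions
import Summits.Ventures.PercRepro2.SwOutAdjSplit
import Summits.Ventures.PercRepro2.SwOutAdjFine
import Summits.Ventures.PercRepro2.SwOutAdjRegion
import Summits.Ventures.PercRepro2.SwOutAdjMatched
import Summits.Ventures.PercRepro2.SwOutAdjCongr
import Summits.Ventures.PercRepro2.SwOutAdjBlock

/-!
# The rigid counting inequality on a block (blind cell PercRepro2, night-4 g11, 2026-08-25;
proofs/NIGHT4-G11.md §5(5))

On the product cube of a block (arms of the split graph ⊕ internal edges) the red edge set of the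
graph grows with the cube point (`redEdges_blockReal_mono`: the split part by the arm principle,
the internal part because the active set and the internal clusters grow), the blue edge set
shrinks, the total flip exchanges them (`blueEdges_blockReal_flipAll`) and the side `Q` is a lower
set (`blockReal_mem_tgtU_of_le`): the generic cube inequality `card_le_of_cube_edges` gives the
rigid counting inequality on the block (`card_block_le`).
-/

namespace Summit.Ventures.PercRepro2

namespace LocRows

open Hull

variable {V : Type*} {E : Type*} [Fintype E] [DecidableEq E]

open scoped Classical

section IneqAux

variable {ends : E → Sym2 V} {S : Set V} {h : V}

omit [Fintype E] [DecidableEq E] in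
/-- A non-internal edge at `S` of an `S`-fine configuration is in the split red edge set iff it is
red. -/
lemma mem_redEdges_splitS_iff_of_afine {η : Config E} (hf : AFine ends S h η) {e : E} {u : V}
    (hu : u ∈ S) (he : u ∈ ends e) (hi : ¬ Internal ends S e) :
    e ∈ redEdges (splitEndsS ends S) η (Sum.inl h) ↔ η e = true := by
  constructor
  · intro h1
    exact (mem_redEdges.1 h1).1
  · intro hred
    have hp := other_notMem_of_not_internal hu he hi
    have h1 := inr_mem_cluster_splitS_of_afine hf hu he hi hred
    have h2 := h1
    rw [inr_mem_cluster_splitS_iff' hu he hp] at h2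
    rw [mem_redEdges, mem_within]
    exact ⟨hred, Sum.inr e, h1, Sum.inl (Sym2.Mem.other he), h2.2,
      splitEndsS_of_not_internal hu he hi⟩

omit [Fintype E] [DecidableEq E] in
/-- The internal cluster grows with the internal red edges and the active set. -/
lemma intCluster_mono {η η' : Config E}
    (hint : ∀ e, Internal ends S e → η e = true → η' e = true)
    (hact : activeRed ends S η ⊆ activeRed ends S η') :
    intCluster ends S h η ⊆ intCluster ends S h η' := by
  rintro x ⟨w, hw, hx⟩
  refine ⟨w, hact hw, ?_⟩
  refine mem_of_conn_of_closed (ends := intEnds ends S h) (ω := η) ?_ (mem_cluster_self _ _ _) hx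
  intro a ha b hab
  obtain ⟨hne, e, he, hends⟩ := openGraph_adj.1 hab
  by_cases hi : Internal ends S e
  · exact mem_cluster_of_edge ha (hint e hi he) hends
  · rw [intEnds_of_not_internal hi, Sym2.eq_iff] at hends
    rcases hends with ⟨h1, h2⟩ | ⟨h1, h2⟩
    · exact absurd (h1.symm.trans h2) hne
    · exact absurd (h2.symm.trans h1) hne

omit [Fintype E] [DecidableEq E] in
/-- Booleans: `a ≤ b` and `a = true` give `b = true`. -/
lemma bool_eq_true_of_le {a b : Bool} (hab : a ≤ b) (ha : a = true) : b = true := by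
  cases a <;> cases b <;> first | rfl | exact absurd ha (by decide) | exact absurd hab (by decide)

omit [Fintype E] [DecidableEq E] in
/-- Booleans: `a ≤ b` and `b = false` give `a = false`. -/
lemma bool_eq_false_of_le {a b : Bool} (hab : a ≤ b) (hb : b = false) : a = false := by
  cases a <;> cases b <;> first | rfl | exact absurd hb (by decide) | exact absurd hab (by decide)

end IneqAux

section Ineq

variable {ends : E → Sym2 V} {U : Set V} {ξ : Config E} {l h o : V} {J : Set V}

variable (hl : l ∉ U) (hloop_h : ∀ e, ends e ≠ s(h, h)) (hJU : J ⊆ U) (hhJ : h ∉ J)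
  (hadj : ∀ u ∈ J, ∀ e (he : u ∈ ends e), Sym2.Mem.other he ≠ h →
    ∃ e', ends e' = s(Sym2.Mem.other he, h))
  (hout : ∀ x ∈ U, x ≠ h → x ≠ o → x ∉ J →
    (∃ e y, ends e = s(x, y) ∧ y ∉ U) ∨ (∀ e, x ∉ ends e))

variable {ζ₁ : Config E} (hζ₁ : ζ₁ ∈ swOutSide ends l h o U ξ)

include hhJ hout hζ₁ in
/-- The split red edge set grows along the block. -/
lemma redEdges_split_blockReal_mono {ω ω' : Config (BlockIdx ends (aSet ends J h ζ₁) h ζ₁)}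
    (hω : ω ≤ ω') :
    redEdges (splitEndsS ends (aSet ends J h ζ₁))
        (blockReal ends (aSet ends J h ζ₁) h ζ₁ ω) (Sum.inl h) ⊆
      redEdges (splitEndsS ends (aSet ends J h ζ₁))
        (blockReal ends (aSet ends J h ζ₁) h ζ₁ ω') (Sum.inl h) := by
  rw [redEdges_splitS_congr (blockReal_agree ω), redEdges_splitS_congr (blockReal_agree ω')]
  exact redEdges_orbitReal_mono (coreFree_blockBase hhJ hout hζ₁) fun P => hω (Sum.inl P)

include hloop_h hhJ hout hζ₁ in
/-- The split blue edge set shrinks along the block. -/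
lemma blueEdges_split_blockReal_anti {ω ω' : Config (BlockIdx ends (aSet ends J h ζ₁) h ζ₁)}
    (hω : ω ≤ ω') :
    blueEdges (splitEndsS ends (aSet ends J h ζ₁))
        (blockReal ends (aSet ends J h ζ₁) h ζ₁ ω') (Sum.inl h) ⊆
      blueEdges (splitEndsS ends (aSet ends J h ζ₁))
        (blockReal ends (aSet ends J h ζ₁) h ζ₁ ω) (Sum.inl h) := by
  rw [blueEdges_splitS_congr (blockReal_agree ω), blueEdges_splitS_congr (blockReal_agree ω')]
  exact blueEdges_orbitReal_anti (coreFree_blockBase hhJ hout hζ₁)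
    (splitEndsS_ne_loop_h hloop_h) fun P => hω (Sum.inl P)

include hloop_h hhJ hout hζ₁ in
/-- The total flip exchanges the split edge sets. -/
lemma blueEdges_split_blockReal_flipAll (ω : Config (BlockIdx ends (aSet ends J h ζ₁) h ζ₁)) :
    blueEdges (splitEndsS ends (aSet ends J h ζ₁))
        (blockReal ends (aSet ends J h ζ₁) h ζ₁ (flipAll ω)) (Sum.inl h) =
      redEdges (splitEndsS ends (aSet ends J h ζ₁))
        (blockReal ends (aSet ends J h ζ₁) h ζ₁ ω) (Sum.inl h) := by
  rw [blueEdges_splitS_congr (blockReal_agree (flipAll ω)),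
    redEdges_splitS_congr (blockReal_agree ω)]
  exact blueEdges_orbitReal_flipAll (coreFree_blockBase hhJ hout hζ₁)
    (splitEndsS_ne_loop_h hloop_h) (ω ∘ Sum.inl)

include hhJ hadj hout hζ₁ in
/-- The active set grows along the block. -/
lemma activeRed_blockReal_mono {ω ω' : Config (BlockIdx ends (aSet ends J h ζ₁) h ζ₁)}
    (hω : ω ≤ ω') :
    activeRed ends (aSet ends J h ζ₁) (blockReal ends (aSet ends J h ζ₁) h ζ₁ ω) ⊆
      activeRed ends (aSet ends J h ζ₁) (blockReal ends (aSet ends J h ζ₁) h ζ₁ ω') := by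
  rintro w ⟨hwM, e, hwe, hi, hred⟩
  refine ⟨hwM, e, hwe, hi, ?_⟩
  have h1 := (mem_redEdges_splitS_iff_of_afine (afine_blockReal hhJ hadj hout hζ₁ ω)
    hwM hwe hi).2 hred
  exact (mem_redEdges_splitS_iff_of_afine (afine_blockReal hhJ hadj hout hζ₁ ω') hwM hwe hi).1
    (redEdges_split_blockReal_mono hhJ hout hζ₁ hω h1)

include hhJ hadj hout hζ₁ in
/-- **The red edge set grows along the block.** -/
theorem redEdges_blockReal_mono {ω ω' : Config (BlockIdx ends (aSet ends J h ζ₁) h ζ₁)}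
    (hω : ω ≤ ω') :
    redEdges ends (blockReal ends (aSet ends J h ζ₁) h ζ₁ ω) h ⊆
      redEdges ends (blockReal ends (aSet ends J h ζ₁) h ζ₁ ω') h := by
  have hhM : h ∉ aSet ends J h ζ₁ := fun h' => hhJ (aSet_subset h')
  rw [redEdges_eq_of_afine hhM (afine_blockReal hhJ hadj hout hζ₁ ω),
    redEdges_eq_of_afine hhM (afine_blockReal hhJ hadj hout hζ₁ ω')]
  refine Set.union_subset_union (redEdges_split_blockReal_mono hhJ hout hζ₁ hω) ?_
  rintro e ⟨hi, hred, hI⟩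
  have hint : ∀ e', Internal ends (aSet ends J h ζ₁) e' →
      blockReal ends (aSet ends J h ζ₁) h ζ₁ ω e' = true →
      blockReal ends (aSet ends J h ζ₁) h ζ₁ ω' e' = true := by
    intro e' hi' h'
    rw [blockReal_of_internal ω' hi']
    rw [blockReal_of_internal ω hi'] at h'
    exact bool_eq_true_of_le (hω (Sum.inr ⟨e', hi'⟩)) h'
  exact ⟨hi, hint e hi hred, fun x hx =>
    intCluster_mono hint (activeRed_blockReal_mono hhJ hadj hout hζ₁ hω) (hI x hx)⟩

include hloop_h hhJ hadj hout hζ₁ in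
/-- The blue active set shrinks along the block. -/
lemma activeRed_blue_blockReal_anti {ω ω' : Config (BlockIdx ends (aSet ends J h ζ₁) h ζ₁)}
    (hω : ω ≤ ω') :
    activeRed ends (aSet ends J h ζ₁) (blue (blockReal ends (aSet ends J h ζ₁) h ζ₁ ω')) ⊆
      activeRed ends (aSet ends J h ζ₁) (blue (blockReal ends (aSet ends J h ζ₁) h ζ₁ ω)) := by
  rintro w ⟨hwM, e, hwe, hi, hblue⟩
  refine ⟨hwM, e, hwe, hi, ?_⟩
  have h1 := (mem_redEdges_splitS_iff_of_afine
    (afine_blue_iff.2 (afine_blockReal hhJ hadj hout hζ₁ ω')) hwM hwe hi).2 hblue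
  exact (mem_redEdges_splitS_iff_of_afine
    (afine_blue_iff.2 (afine_blockReal hhJ hadj hout hζ₁ ω)) hwM hwe hi).1
    (blueEdges_split_blockReal_anti hloop_h hhJ hout hζ₁ hω h1)

include hloop_h hhJ hadj hout hζ₁ in
/-- **The blue edge set shrinks along the block.** -/
theorem blueEdges_blockReal_anti {ω ω' : Config (BlockIdx ends (aSet ends J h ζ₁) h ζ₁)}
    (hω : ω ≤ ω') :
    blueEdges ends (blockReal ends (aSet ends J h ζ₁) h ζ₁ ω') h ⊆
      blueEdges ends (blockReal ends (aSet ends J h ζ₁) h ζ₁ ω) h := by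
  have hhM : h ∉ aSet ends J h ζ₁ := fun h' => hhJ (aSet_subset h')
  rw [blueEdges_eq_of_afine hhM (afine_blockReal hhJ hadj hout hζ₁ ω),
    blueEdges_eq_of_afine hhM (afine_blockReal hhJ hadj hout hζ₁ ω')]
  refine Set.union_subset_union (blueEdges_split_blockReal_anti hloop_h hhJ hout hζ₁ hω) ?_
  rintro e ⟨hi, hblue, hI⟩
  have hint : ∀ e', Internal ends (aSet ends J h ζ₁) e' →
      blue (blockReal ends (aSet ends J h ζ₁) h ζ₁ ω') e' = true →
      blue (blockReal ends (aSet ends J h ζ₁) h ζ₁ ω) e' = true := by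
    intro e' hi' h'
    rw [blue_eq_true_iff, blockReal_of_internal ω hi']
    rw [blue_eq_true_iff, blockReal_of_internal ω' hi'] at h'
    exact bool_eq_false_of_le (hω (Sum.inr ⟨e', hi'⟩)) h'
  exact ⟨hi, hint e hi hblue, fun x hx =>
    intCluster_mono hint (activeRed_blue_blockReal_anti hloop_h hhJ hadj hout hζ₁ hω) (hI x hx)⟩

include hloop_h hhJ hadj hout hζ₁ in
/-- The total flip exchanges the active sets. -/
lemma activeRed_blue_blockReal_flipAll (ω : Config (BlockIdx ends (aSet ends J h ζ₁) h ζ₁)) :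
    activeRed ends (aSet ends J h ζ₁) (blue (blockReal ends (aSet ends J h ζ₁) h ζ₁ (flipAll ω))) =
      activeRed ends (aSet ends J h ζ₁) (blockReal ends (aSet ends J h ζ₁) h ζ₁ ω) := by
  ext w
  simp only [activeRed, Set.mem_setOf_eq]
  refine and_congr_right fun hwM => exists_congr fun e => and_congr_right fun hwe =>
    and_congr_right fun hi => ?_
  rw [← mem_redEdges_splitS_iff_of_afine
    (afine_blue_iff.2 (afine_blockReal hhJ hadj hout hζ₁ (flipAll ω))) hwM hwe hi,
    ← mem_redEdges_splitS_iff_of_afine (afine_blockReal hhJ hadj hout hζ₁ ω) hwM hwe hi]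
  exact Set.ext_iff.1 (blueEdges_split_blockReal_flipAll hloop_h hhJ hout hζ₁ ω) e

include hloop_h hhJ hadj hout hζ₁ in
/-- **The total flip exchanges the edge sets.** -/
theorem blueEdges_blockReal_flipAll (ω : Config (BlockIdx ends (aSet ends J h ζ₁) h ζ₁)) :
    blueEdges ends (blockReal ends (aSet ends J h ζ₁) h ζ₁ (flipAll ω)) h =
      redEdges ends (blockReal ends (aSet ends J h ζ₁) h ζ₁ ω) h := by
  have hhM : h ∉ aSet ends J h ζ₁ := fun h' => hhJ (aSet_subset h')
  rw [blueEdges_eq_of_afine hhM (afine_blockReal hhJ hadj hout hζ₁ (flipAll ω)),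
    redEdges_eq_of_afine hhM (afine_blockReal hhJ hadj hout hζ₁ ω),
    blueEdges_split_blockReal_flipAll hloop_h hhJ hout hζ₁ ω]
  congr 1
  have hint : ∀ e', Internal ends (aSet ends J h ζ₁) e' →
      blue (blockReal ends (aSet ends J h ζ₁) h ζ₁ (flipAll ω)) e' =
        blockReal ends (aSet ends J h ζ₁) h ζ₁ ω e' := by
    intro e' hi'
    rw [blue_apply, blockReal_of_internal (flipAll ω) hi', blockReal_of_internal ω hi']
    simp only [flipAll, Bool.not_not]
  have hact := activeRed_blue_blockReal_flipAll hloop_h hhJ hadj hout hζ₁ ω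
  have hI : intCluster ends (aSet ends J h ζ₁) h
      (blue (blockReal ends (aSet ends J h ζ₁) h ζ₁ (flipAll ω))) =
      intCluster ends (aSet ends J h ζ₁) h (blockReal ends (aSet ends J h ζ₁) h ζ₁ ω) :=
    Set.Subset.antisymm
      (intCluster_mono (fun e' hi' h' => by rw [← hint e' hi']; exact h') hact.le)
      (intCluster_mono (fun e' hi' h' => by rw [hint e' hi']; exact h') hact.ge)
  ext e
  simp only [Set.mem_setOf_eq]
  constructor
  · rintro ⟨hi, hb, hI'⟩
    exact ⟨hi, by rw [← hint e hi]; exact hb, fun x hx => hI ▸ hI' x hx⟩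
  · rintro ⟨hi, hb, hI'⟩
    exact ⟨hi, by rw [hint e hi]; exact hb, fun x hx => hI.symm ▸ hI' x hx⟩

include hl hJU hhJ hadj hout hζ₁ in
/-- **The side `Q` is a lower set on the block.** -/
theorem blockReal_mem_tgtU_of_le {ω ω' : Config (BlockIdx ends (aSet ends J h ζ₁) h ζ₁)}
    (hω : ω ≤ ω')
    (hQ : blockReal ends (aSet ends J h ζ₁) h ζ₁ ω' ∈ tgtU ends l h {S : Set V | o ∈ S}) :
    blockReal ends (aSet ends J h ζ₁) h ζ₁ ω ∈ tgtU ends l h {S : Set V | o ∈ S} := by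
  have hlM : l ∉ aSet ends J h ζ₁ := fun h' => hl (hJU (aSet_subset h'))
  have h1 := mem_tgtU_splitS_of_mem' (afine_blockReal hhJ hadj hout hζ₁ ω') hlM hQ
  have h2 := mem_tgtU_splitS_congr (blockReal_agree ω') h1
  have h3 := orbitReal_mem_tgtU_of_le (coreFree_blockBase hhJ hout hζ₁)
    (blockBase_mem_outClass hJU hhJ hout hζ₁) (inl_notMem_splitRegionS (V := V) (E := E) hl)
    (fun P => hω (Sum.inl P)) h2
  have h4 := mem_tgtU_splitS_congr (fun e hi => (blockReal_agree ω e hi).symm) h3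
  exact mem_tgtU_of_mem_splitS' hlM (afine_blockReal hhJ hadj hout hζ₁ ω) h4

include hl hloop_h hJU hhJ hadj hout hζ₁ in
/-- **The rigid counting inequality on a block.** -/
theorem card_block_le {𝓔 : Set (Set E)} (h𝓔 : IsUpperSet 𝓔) :
    ((Finset.univ.image (blockReal ends (aSet ends J h ζ₁) h ζ₁)).filter fun ζ =>
        ζ ∈ tgtU ends l h {S : Set V | o ∈ S} ∧ redEdges ends ζ h ∈ 𝓔).card ≤
      ((Finset.univ.image (blockReal ends (aSet ends J h ζ₁) h ζ₁)).filter fun ζ =>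
        ζ ∈ tgtU ends l h {S : Set V | o ∈ S} ∧ blueEdges ends ζ h ∈ 𝓔).card := by
  have key := card_le_of_cube_edges (ends := ends) (blockReal ends (aSet ends J h ζ₁) h ζ₁)
    (blockReal_injective ζ₁) (Finset.univ.image (blockReal ends (aSet ends J h ζ₁) h ζ₁))
    (fun ζ => by simp only [Finset.mem_image, Finset.mem_univ, true_and])
    (↑(tgtU ends l h {S : Set V | o ∈ S}))
    (fun ω' ω hω hQ => blockReal_mem_tgtU_of_le hl hJU hhJ hadj hout hζ₁ hω hQ) h
    (fun 𝓔' h𝓔' ω ω' hω hω𝓔 => h𝓔' (redEdges_blockReal_mono hhJ hadj hout hζ₁ hω) hω𝓔)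
    (fun 𝓔' h𝓔' ω' ω hω hω𝓔 => h𝓔' (blueEdges_blockReal_anti hloop_h hhJ hadj hout hζ₁ hω) hω𝓔)
    (fun ω => blueEdges_blockReal_flipAll hloop_h hhJ hadj hout hζ₁ ω) h𝓔
  simpa only [Finset.mem_coe] using key

end Ineq

end LocRows

end Summit.Ventures.PercRepro2
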